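import Literature.NumberTheory.EllipticCurves.GaloisAction
import Summits.BirchSwinnertonDyer.BirchSwinnertonDyer.Theorems.GenusKolyvaginAtTwoTorsionCellGenusDepthTorsion
import Summits.BirchSwinnertonDyer.BirchSwinnertonDyer.Theorems.GenusKolyvaginAtTwoTorsionCellGenusDepthCharacters
import HarnessLib

/-!
# LINE 49 «full_vertex» — the (LOW) dictionary ON POINTS: `E(L)` under `Gal(L/F) ≅ (ℤ/2)^k` (pen memo #6 §2.1, concrete form)

Crux R″ `RankOneTwoTorsionResidualAtTwo` (stmt-BirchSwinnertonDyer-27478) of route GenusKolyvaginAtTwo, LINE 49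
«torsion_cell_full_vertex_bsdidea1» (pen bsd-idea-1).  The abstract genus-depth package (`…GenusDepth`: Theorem A;
`…GenusDepthTorsion`: modulo torsion; `…GenusDepthCharacters`: `hdual`/`hsep` for elementary abelian `2`-groups) is read
here on the object of memo #6 itself: the `L`-points `E(L) = (W.baseChange L).toAffine.Point` of a Weierstrass curve `W/F`
under the tree's Galois action `σ • P = Point.map σ P` (`WeierstrassCurve.instDistribMulActionAlgEquivPoint`,
`GaloisAction.lean`), for a finite extension `L/F` whose automorphism group is an elementary abelian `2`-group of order `2^k`
(the genus field `K_gen = K(√q₁*, …)` over `K`).  With one `χ`-eigenvector `g χ ∈ E(L)` per character `χ : Gal →* ℤˣ`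
(the odd-twist generators `g′_d` moved into `E(K_gen)`) and `M′ = Σ ℤ g χ`:

* **`two_pow_smul_mem_span_sup_torsion_iff_point`** — `2^e • y ∈ M′ + E(L)_tors ↔` every twisted trace
  `∑ σ, χ σ • σ • y` lies in `2^(k−e) ℤ g χ + E(L)_tors`;
* **`two_smul_mem_span_sup_torsion_iff_point`** (`e = 1`) — «(LOW)^{∀χ}_k ⟺ 2 • y_G ∈ M′ + tors» for the genus trace `y = y_G`;
* `twistedTrace_sub_smul_mem_torsion_of_decomposition_point` — Theorem A (⟸) on points;
* `exists_character_apply_ne_one_gal`, `card_characters_gal_eq_two_pow` — the two standing hypotheses, discharged.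

No Heegner point, no `L`-function and no statement of the line occurs here: this is the algebraic skeleton only, and NOTHING
HERE PROVES R″ or any summit — BSD is not advanced by this file alone.

## References

* [Serre1977] §2.3/§3.1; [TianYuanZhang2017] §1 (genus points as twisted traces); [SilvermanAEC2009] VIII.§1 (the action).
-/

noncomputable section

open scoped Classical

namespace Summit.BirchSwinnertonDyer.BirchSwinnertonDyer.Theorems.GenusKolyvaginAtTwo.FullVertex.GenusDepth

open BigOperators Finset WeierstrassCurve

universe u

variable {F L : Type u} [Field F] [Field L] [Algebra F L] [FiniteDimensional F L] (W : WeierstrassCurve F)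

/-- `hsep` for `Gal(L/F)` an elementary abelian `2`-group: the `ℤˣ`-valued characters separate the automorphisms.
[cite: Serre1977, §3.1] -/
theorem exists_character_apply_ne_one_gal (h2 : ∀ σ : L ≃ₐ[F] L, σ * σ = 1) {σ : L ≃ₐ[F] L} (hσ : σ ≠ 1) :
    ∃ χ : (L ≃ₐ[F] L) →* ℤˣ, χ σ ≠ 1 :=
  exists_monoidHom_unitsInt_apply_ne_one h2 hσ

/-- `hdual` for `Gal(L/F)` an elementary abelian `2`-group of order `2^k`: there are exactly `2^k` characters.
[cite: Serre1977, §3.1] -/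
theorem card_characters_gal_eq_two_pow [Fintype ((L ≃ₐ[F] L) →* ℤˣ)] (h2 : ∀ σ : L ≃ₐ[F] L, σ * σ = 1) {k : ℕ}
    (hG : Fintype.card (L ≃ₐ[F] L) = 2 ^ k) : Fintype.card ((L ≃ₐ[F] L) →* ℤˣ) = 2 ^ k :=
  card_monoidHom_unitsInt_eq_two_pow h2 hG

/-- **THEOREM A (⟸) on `E(L)`.**  `|Gal(L/F)| = 2^k`, `e ≤ k`, characters `χᵢ` pairwise distinct, points `Pᵢ ∈ E(L)` with
`σ • Pᵢ = χᵢ(σ) • Pᵢ`, and `2^e • y − ∑ᵢ Pᵢ ∈ E(L)_tors` ⟹ `∑ σ, χᵢ σ • σ • y − 2^(k−e) • Pᵢ ∈ E(L)_tors`.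
[cite: TianYuanZhang2017, §1] -/
theorem twistedTrace_sub_smul_mem_torsion_of_decomposition_point {k e : ℕ} (hG : Fintype.card (L ≃ₐ[F] L) = 2 ^ k)
    (he : e ≤ k) {ι : Type*} [Fintype ι] [DecidableEq ι] (χ : ι → ((L ≃ₐ[F] L) →* ℤˣ)) (hχ : Function.Injective χ)
    (P : ι → (W.baseChange L).toAffine.Point)
    (hP : ∀ i, ∀ σ : L ≃ₐ[F] L, σ • P i = ((χ i σ : ℤˣ) : ℤ) • P i) (y : (W.baseChange L).toAffine.Point)
    (hy : ((2 : ℤ) ^ e) • y - ∑ j, P j ∈ AddCommGroup.torsion (W.baseChange L).toAffine.Point) (i : ι) :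
    ∑ σ : L ≃ₐ[F] L, ((χ i σ : ℤˣ) : ℤ) • σ • y - ((2 : ℤ) ^ (k - e)) • P i ∈
      AddCommGroup.torsion (W.baseChange L).toAffine.Point :=
  twistedTrace_sub_smul_mem_torsion_of_decomposition hG he χ hχ P hP y hy i

/-- **THE (LOW) DICTIONARY ON `E(L)`.**  For `Gal(L/F)` elementary abelian of order `2^k` (`σ² = 1`), one eigenvector
`g χ ∈ E(L)` per character and `e ≤ k`:
`2^e • y ∈ (Σ ℤ g χ) + E(L)_tors ↔ ∀ χ, ∃ a : ℤ, ∑ σ, χ σ • σ • y − (2^(k−e)·a) • g χ ∈ E(L)_tors` — the hypotheses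
`hdual`, `hsep` of the abstract dictionary being DISCHARGED by `…GenusDepthCharacters`. [cite: TianYuanZhang2017, §1] -/
theorem two_pow_smul_mem_span_sup_torsion_iff_point [Fintype ((L ≃ₐ[F] L) →* ℤˣ)] {k e : ℕ}
    (hG : Fintype.card (L ≃ₐ[F] L) = 2 ^ k) (h2 : ∀ σ : L ≃ₐ[F] L, σ * σ = 1) (he : e ≤ k)
    (g : ((L ≃ₐ[F] L) →* ℤˣ) → (W.baseChange L).toAffine.Point)
    (hg : ∀ χ : (L ≃ₐ[F] L) →* ℤˣ, ∀ σ : L ≃ₐ[F] L, σ • g χ = ((χ σ : ℤˣ) : ℤ) • g χ)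
    (y : (W.baseChange L).toAffine.Point) :
    ((2 : ℤ) ^ e) • y ∈ (Submodule.span ℤ (Set.range g)).toAddSubgroup ⊔
        AddCommGroup.torsion (W.baseChange L).toAffine.Point ↔
      ∀ χ : (L ≃ₐ[F] L) →* ℤˣ, ∃ a : ℤ,
        ∑ σ : L ≃ₐ[F] L, ((χ σ : ℤˣ) : ℤ) • σ • y - (((2 : ℤ) ^ (k - e)) * a) • g χ ∈
          AddCommGroup.torsion (W.baseChange L).toAffine.Point :=
  two_pow_smul_mem_span_sup_torsion_iff hG (card_monoidHom_unitsInt_eq_two_pow h2 hG)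
    (fun _ hσ => exists_monoidHom_unitsInt_apply_ne_one h2 hσ) he g hg y

/-- **(LOW)^{∀χ}_k ⟺ `2 • y_G ∈ M′ + tors` on `E(L)`** (`e = 1`, `k ≥ 1`): twice the genus trace is a sum of the rational
twist points up to torsion iff EVERY twisted trace `y_χ = ∑ σ, χ σ • σ • y_G` lies in `2^(k−1) ℤ g χ + E(L)_tors`.
[cite: TianYuanZhang2017, §1] -/
theorem two_smul_mem_span_sup_torsion_iff_point [Fintype ((L ≃ₐ[F] L) →* ℤˣ)] {k : ℕ}
    (hG : Fintype.card (L ≃ₐ[F] L) = 2 ^ k) (h2 : ∀ σ : L ≃ₐ[F] L, σ * σ = 1) (hk : 1 ≤ k)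
    (g : ((L ≃ₐ[F] L) →* ℤˣ) → (W.baseChange L).toAffine.Point)
    (hg : ∀ χ : (L ≃ₐ[F] L) →* ℤˣ, ∀ σ : L ≃ₐ[F] L, σ • g χ = ((χ σ : ℤˣ) : ℤ) • g χ)
    (y : (W.baseChange L).toAffine.Point) :
    (2 : ℤ) • y ∈ (Submodule.span ℤ (Set.range g)).toAddSubgroup ⊔
        AddCommGroup.torsion (W.baseChange L).toAffine.Point ↔
      ∀ χ : (L ≃ₐ[F] L) →* ℤˣ, ∃ a : ℤ,
        ∑ σ : L ≃ₐ[F] L, ((χ σ : ℤˣ) : ℤ) • σ • y - (((2 : ℤ) ^ (k - 1)) * a) • g χ ∈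
          AddCommGroup.torsion (W.baseChange L).toAffine.Point :=
  two_smul_mem_span_sup_torsion_iff hG (card_monoidHom_unitsInt_eq_two_pow h2 hG)
    (fun _ hσ => exists_monoidHom_unitsInt_apply_ne_one h2 hσ) hk g hg y

/-- **EXPONENT on `E(L)`** (memo #6 §2.3): if every `χ`-eigenvector of `E(L)` is an integer multiple of `g χ` up to torsion
(rank-one eigenlines), then `2^k • x ∈ (Σ ℤ g χ) + E(L)_tors` for EVERY `x ∈ E(L)`. [cite: TianYuanZhang2017, §1] -/
theorem two_pow_card_smul_mem_span_sup_torsion_point [Fintype ((L ≃ₐ[F] L) →* ℤˣ)] {k : ℕ}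
    (hG : Fintype.card (L ≃ₐ[F] L) = 2 ^ k) (h2 : ∀ σ : L ≃ₐ[F] L, σ * σ = 1)
    (g : ((L ≃ₐ[F] L) →* ℤˣ) → (W.baseChange L).toAffine.Point)
    (hsat : ∀ χ : (L ≃ₐ[F] L) →* ℤˣ, ∀ P : (W.baseChange L).toAffine.Point,
      (∀ σ : L ≃ₐ[F] L, σ • P = ((χ σ : ℤˣ) : ℤ) • P) →
        ∃ a : ℤ, P - a • g χ ∈ AddCommGroup.torsion (W.baseChange L).toAffine.Point)
    (x : (W.baseChange L).toAffine.Point) :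
    ((2 : ℤ) ^ k) • x ∈ (Submodule.span ℤ (Set.range g)).toAddSubgroup ⊔
      AddCommGroup.torsion (W.baseChange L).toAffine.Point :=
  two_pow_card_smul_mem_span_sup_torsion (card_monoidHom_unitsInt_eq_two_pow h2 hG)
    (fun _ hσ => exists_monoidHom_unitsInt_apply_ne_one h2 hσ) g hsat x

end Summit.BirchSwinnertonDyer.BirchSwinnertonDyer.Theorems.GenusKolyvaginAtTwo.FullVertex.GenusDepth

end
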